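import Summits.ResolutionOfSingularities.ResolutionOfSingularities.Theorems.FrobeniusLadderFRationalResolutionBlowupRegularCompletionAscent
import Summits.ResolutionOfSingularities.ResolutionOfSingularities.Theorems.FrobeniusLadderFRationalResolutionSegreChartRegular
import Summits.ResolutionOfSingularities.ResolutionOfSingularities.Theorems.FrobeniusLadderFRationalResolutionBlowupOrbitCentre
import HarnessLib

/-!
# Crux `FrobeniusLadder.FRationalResolution` (stmt-ResolutionOfSingularities-15317), line `redirect`,
# stub `stub_diagonalizableQuotientResolution` — `Bl_𝔪`-REGULARITY OF A LOCAL RING DEPENDS ONLY ON ITS COMPLETION; THE CONIFOLD LOCAL INPUT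
# (the hypothesis `hloc : Scheme.IsRegular (affineBlowup (maximalIdeal 𝒪_{X₁,z}))` of `…PointCentreBlowupRegular` / `…MaximalIdealTower`,
# MEMO-15317-leafhand2-g17 §3 «conifold local input»)

For a Noetherian local ring `𝒪` whose completion is isomorphic to the completion of `B_𝔮`, `B` of finite type over a field, `𝔮` maximal
with `Bl_𝔮(Spec B)` regular, the blowing up `Bl_{𝔪}(Spec 𝒪)` is regular: ascend `B → B_𝔮 → (B_𝔮)^` (G-ring, tree
`…BlowupRegularCompletionAscent.isRegular_affineBlowup_adicCompletion_of_isRegular`, p838626), transport along the ring isomorphism (it matches the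
maximal ideals), and descend `𝒪 → 𝒪̂` by faithful flatness (tree `…BlowupRegularFlatChart.isRegular_affineBlowup_of_adicCompletion`, p837844). The model
case needed by the intrinsic recipe is the ordinary double point `xy = zw` = the vertex of the Segre cone `C(ℙ¹ × ℙ¹)`, whose vertex blow-up is regular
by the cone programme (`…SegreChartRegular.stub_segre_chart_isRegularRing`, p794413).

* `map_maximalIdeal_ringEquiv` — a ring isomorphism of local rings maps the maximal ideal ONTO the maximal ideal;
* ★ `isRegular_affineBlowup_maximalIdeal_of_ringEquiv_adicCompletion` — `𝒪̂ ≅ (B_𝔮)^`, `Bl_𝔮(Spec B)` regular ⇒ `Bl_𝔪(Spec 𝒪)` regular;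
* `isRegular_affineBlowup_segreVertex` — `Bl_{(xᵢyⱼ)}(Spec k[xᵢyⱼ])` is regular (all Segre cones, every field; extracted from p794413's charts);
* `finiteType_segreRing` — the Segre ring is of finite type over `k`; so, by ★ with `B = k[xᵢyⱼ]`, `𝔮 = (xᵢyⱼ)`: **a Noetherian local ring whose
  completion is isomorphic to that of the vertex of a Segre cone (e.g. the 3-fold ordinary double point `xy = zw`, `a = b = 2`) is resolved by
  ONE blow-up of its maximal ideal** (the two inputs of ★ are supplied here; the instantiation is left to the consumer, who holds `𝔮.IsMaximal`).

Honest label: plumbing toward ONE leaf stub (no stub, crux or summit closed). No definitions, no named facts, no sorry.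
[cite: Matsumura1987, Thm. 8.14; Thm. 23.7; §32, Cor. of Thm. 32.6] [cite: GortzWedhorn2020, Prop. 13.91 (2), (4)] [cite: Kollar2007, §2.2]
-/

noncomputable section

-- single-problem summit: the doubled namespace component is forced
set_option linter.dupNamespace false

open MvPolynomial AlgebraicGeometry IsLocalRing
open Literature.AlgebraicGeometry.Resolution
open Summit.ResolutionOfSingularities.ResolutionOfSingularities.Theorems.FRationalResolution

namespace Summit.ResolutionOfSingularities.ResolutionOfSingularities.Theorems.FRationalResolution.PointBlowupOfCompletion

/-! ## §1 Ring isomorphisms of local rings match the maximal ideals -/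

/-- A ring isomorphism between local rings maps the maximal ideal onto the maximal ideal. [folklore] -/
theorem map_maximalIdeal_ringEquiv {R S : Type} [CommRing R] [CommRing S] [IsLocalRing R] [IsLocalRing S] (e : R ≃+* S) :
    (maximalIdeal R).map (e : R →+* S) = maximalIdeal S := by
  refine le_antisymm ?_ ?_
  · rw [Ideal.map_le_iff_le_comap]
    intro x hx
    rw [Ideal.mem_comap, mem_maximalIdeal, mem_nonunits_iff]
    intro hu
    rw [mem_maximalIdeal, mem_nonunits_iff] at hx
    exact hx (by simpa using hu.map (e.symm : S →+* R))
  · intro y hy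
    have hy' : e.symm y ∈ maximalIdeal R := by
      rw [mem_maximalIdeal, mem_nonunits_iff] at hy ⊢
      intro hu
      exact hy (by simpa using hu.map (e : R →+* S))
    have h := Ideal.mem_map_of_mem (e : R →+* S) hy'
    rwa [RingHom.coe_coe, RingEquiv.apply_symm_apply] at h

/-! ## §2 `Bl_𝔪`-regularity depends only on the completion -/

/-- ★ **`Bl_𝔪(Spec 𝒪)` is regular as soon as `𝒪̂ ≅ (B_𝔮)^` with `Bl_𝔮(Spec B)` regular**, `B` of finite type over a field, `𝔮` maximal.
[cite: Matsumura1987, Thm. 8.14; Thm. 23.7; §32, Cor. of Thm. 32.6] [cite: GortzWedhorn2020, Prop. 13.91 (2)] -/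
theorem isRegular_affineBlowup_maximalIdeal_of_ringEquiv_adicCompletion (K : Type) [Field K] {B : Type} [CommRing B] [Algebra K B]
    [Algebra.FiniteType K B] (𝔮 : Ideal B) [𝔮.IsMaximal] (hreg : Scheme.IsRegular (affineBlowup 𝔮))
    {𝒪 : Type} [CommRing 𝒪] [IsNoetherianRing 𝒪] [IsLocalRing 𝒪]
    (e : AdicCompletion (maximalIdeal (Localization.AtPrime 𝔮)) (Localization.AtPrime 𝔮) ≃+* AdicCompletion (maximalIdeal 𝒪) 𝒪) :
    Scheme.IsRegular (affineBlowup (maximalIdeal 𝒪)) := by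
  have hB : IsGRing B := Matsumura1987_32_6_cor_holds.{0} K B ‹_›
  haveI : IsNoetherianRing B := hB.1
  haveI : IsNoetherianRing (Localization.AtPrime 𝔮) :=
    IsLocalization.isNoetherianRing 𝔮.primeCompl (Localization.AtPrime 𝔮) inferInstance
  -- ascend `B → B_𝔮 → (B_𝔮)^`
  have h1 := BlowupRegularCompletionAscent.isRegular_affineBlowup_adicCompletion_of_isRegular hB 𝔮 𝔮 hreg
  rw [Localization.AtPrime.map_eq_maximalIdeal, ← AdicCompletion.maximalIdeal_eq_map] at h1
  -- transport along `e`
  have h2 := BlowupOrbitCentre.isRegular_affineBlowup_map_of_ringEquiv e _ h1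
  rw [map_maximalIdeal_ringEquiv e, AdicCompletion.maximalIdeal_eq_map] at h2
  -- descend `𝒪 → 𝒪̂`
  exact BlowupRegularFlatChart.isRegular_affineBlowup_of_adicCompletion (maximalIdeal 𝒪) h2

/-! ## §3 The model: the vertex of a Segre cone -/

section Segre

variable (k : Type) [Field k]

/-- **`Bl_{(xᵢyⱼ)}(Spec k[xᵢyⱼ])` is regular** for every field and all `a, b` (vacuous for `a = 0` or `b = 0`): the charts `D₊(xᵢyⱼ t)` cover the blowing up and each
`k[xᵢyⱼ][SM/xᵢyⱼ] ≅ 𝔸^{a+b-1}` is a regular ring (`stub_segre_chart_isRegularRing`, p794413; assembled exactly as in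
`…SegreConeResolution.hasResolution_segreCone`). [cite: GortzWedhorn2020, Prop. 13.91 (4)] [cite: Kollar2007, §2.2] -/
theorem isRegular_affineBlowup_segreVertex (a b : ℕ) :
    Scheme.IsRegular (affineBlowup (Ideal.span {v : ↥(Algebra.adjoin k (Set.range (fun ij : Fin a × Fin b =>
        (MvPolynomial.X (R := k) (σ := Fin a ⊕ Fin b) (Sum.inl ij.1) *
          MvPolynomial.X (R := k) (σ := Fin a ⊕ Fin b) (Sum.inr ij.2) : MvPolynomial (Fin a ⊕ Fin b) k)))) |
      ∃ ij : Fin a × Fin b, (v : MvPolynomial (Fin a ⊕ Fin b) k) = MvPolynomial.X (Sum.inl ij.1) * MvPolynomial.X (Sum.inr ij.2)})) := by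
  refine affineBlowup.isRegular_of_isRegularRing_blowupAlgebra
    (fun ij : Fin a × Fin b => (⟨MvPolynomial.X (Sum.inl ij.1) * MvPolynomial.X (Sum.inr ij.2),
      segreChart_X_mul_X_mem k a b ij.1 ij.2⟩ : ↥(Algebra.adjoin k (Set.range (fun ij : Fin a × Fin b =>
        (MvPolynomial.X (R := k) (σ := Fin a ⊕ Fin b) (Sum.inl ij.1) *
          MvPolynomial.X (R := k) (σ := Fin a ⊕ Fin b) (Sum.inr ij.2) : MvPolynomial (Fin a ⊕ Fin b) k))))))
    (fun ij => segreChart_gen_mem_SM k a b ij.1 ij.2) ?_ (fun ij => stub_segre_chart_isRegularRing k a b ij.1 ij.2 _ rfl)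
  refine Ideal.span_le.mpr ?_
  rintro v ⟨ij, hv⟩
  refine Ideal.subset_span ⟨ij, Subtype.ext ?_⟩
  exact hv.symm

end Segre

/-- The Segre ring is of finite type over `k` (finitely many generators `xᵢyⱼ`). [folklore] -/
theorem finiteType_segreRing (k : Type) [Field k] (a b : ℕ) :
    Algebra.FiniteType k ↥(Algebra.adjoin k (Set.range (fun ij : Fin a × Fin b =>
        (MvPolynomial.X (R := k) (σ := Fin a ⊕ Fin b) (Sum.inl ij.1) *
          MvPolynomial.X (R := k) (σ := Fin a ⊕ Fin b) (Sum.inr ij.2) : MvPolynomial (Fin a ⊕ Fin b) k)))) := by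
  rw [← Subalgebra.fg_iff_finiteType, Subalgebra.fg_def]
  exact ⟨_, Set.finite_range _, rfl⟩

end Summit.ResolutionOfSingularities.ResolutionOfSingularities.Theorems.FRationalResolution.PointBlowupOfCompletion

end
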